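import Summits.QuantumFields.YangMills.Theorems.BalabanUVNodesN22W1StripN18Edge
import Literature.MathematicalPhysics.QuantumFieldTheory.Balaban1983to89.Node00.RateRecordW1Maps

/-!
# BalabanUVNodes ∕ node N22 = NE9 — THE STRIP INDUCTION AT THE W1 OBJECT, MODULE 10: THE EDGE N18 → N22 AT node00-def-W1's READING DATA OF RECORD
# `ReadingData.ofRecord` — module 9's pairing-coherence clauses (C1)(C2) DISCHARGED by the pairing of record `pairOfRecord` and the pinned readings, so that
# `S_N22 (RRec₁₂ 𝔯)` follows from `S_N18 (RRec₁₂ 𝔯)` + STRIP-(1.18) + the junk-freeness pin + the inputs' numerals ONLY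

Cell `pub-ymgap`, HUMAN RULING D-0062 (Track A), R134 ACCELERATION re-seat `pub-ymgap-dag-n22-c` (strategy s1), generation 3, module 10 = trigger (t2)∕(t3) of the
seat's HANDOFF fired by node00-def-W1 g3's `Node00/RateRecordW1Maps.lean` (p473218 ✓ 85fb888b543f: `domSys_succ`, `castDom`, `pairOfRecord` with the faces
`pairOfRecord_fst` (`rfl`), `dj_pairOfRecord`, `range_pairOfRecord = {Y | Y.1 ≠ 0}`; `LevelPairing.ofRecord` = W1 g2's `LevelPairing` with run A = the `SU(N)` gauge
fields of `F.P k`, run B = those of `F.P (k+1)`, both read through `ιSU N` with `𝐉 = 0`, `pair := pairOfRecord`, the gauge and the one-step transport `T₀`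
parameters; `ReadingData.ofRecord`; `ReadingData.ne5_ofRecord_iff`).  THEOREMS ONLY; imports module 9 `…N22W1StripN18Edge` (the edge along ANY coherent level
pairings) and `Node00.RateRecordW1Maps` BY NAME.  `--supports` K3′ (helper).

WHY.  Module 9 derives ROAD 3's oscillation-fading input (O) at the named W1 reading from node N18's NE5 along the level pairings, under the DISPLAYED coherence
clauses (C1) «`pair` raises the creation step by one, preserves `d_j`, reaches every domain of creation step `≥ 1`» and (C2) «run A of pairing `k+1` reads inside
run B of pairing `k`».  At the reading data OF RECORD both are THEOREMS: (C1) = `pairOfRecord_fst` ∕ `dj_pairOfRecord` ∕ `range_pairOfRecord`; (C2) = `rfl` (both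
background slots are `GaugeField (F.P (k+1)) 0 (SU N)` read by `ofBackgroundC (ιSU N)`).  So at `ReadingData.ofRecord` the edge N18 → N22 holds modulo the
junk-freeness pin (J) «the run of `k` steps creates no term after step `k`», the letter inputs' numerals and STRIP-(1.18) (⇐ the level-T one-step hypothesis,
modules 1∕3) — and node N18's stub itself.

WHAT.
* §1 `pairingCoherence_ofRecord` — (C1)(C2) for `ReadingData.ofRecord F M N S gauge hg T₀ li` (any towers, gauge, transport, letters).
* §2 `oscFading_ofRecord_of_ne5_below` — (O) for `Re E(S k)(X; ·; (ιU, 0))` from NE5 below in node00-def-W1's literal (`ne5_ofRecord_iff`) + (J) only;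
  `n22At_u3OfRecord₁₂_ofRecord_of_n18Below_stripBound` — `N22At` at the level-`k` Stage-12 bundle of the reading of record from STRIP + N18 below + (J) + numerals.
* §3 `s_N22_readingOfRecord₁₂_ofRecord_of_s_N18_stripBound` — THE EDGE at dag-n22-e's edition-1 reading of record with W1 component
  `w1 := fun F θ ↦ ReadingData.ofRecord F θ.τ9.M N (S F θ) (gauge F θ) (hg F θ) (T₀ F θ) (li F θ)` (node00-def-W1 g3's suggested instance):
  `S_N18 (RRec₁₂ 𝔯) →` (J) `→` numerals `→` STRIP per run length `→ S_N22 (RRec₁₂ 𝔯)`.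

HONEST FRAMING.  Count-neutral by-name knit; NOT a discharge of N22: STRIP ⇐ the displayed level-T hypothesis (N10's lane), (J) is a reading pin displayed here (the
definer sets the steps `≥ k` of the run-length-`k` tower termless), the numerals are the reading's, readings-in-the-spaces is Theorem-1 content, and `S_N18` is node
N18's stub — a hypothesis, NOT proved; no inhabitant of `IsDatumOfRecord₁₂C` claimed (K0′); the towers `S`, the gauge, `T₀` and the letters stay parameters.  NE5 ∕ NE9
NOT IN PRINT; one finite four-torus programme at fixed ε — NOT infinite volume, NOT OS on ℝ⁴, NOT a mass gap, NOT Clay.  0 `sorry`, 0 `def`, standard axioms.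

References (TYPES only): [I] = [Balaban1987RG1] (0.8)–(0.10) p. 253, (0.24)–(0.25) p. 257, Thm 1 p. 259, (1.18) p. 263; [II] = [Balaban1988RG2Cluster] (2.13)–(2.14)
pp. 14–15, (2.40)–(2.41) p. 21.
-/

noncomputable section

namespace YMDAG.N22.W1

open Set Metric
open scoped BigOperators
open Literature.MathematicalPhysics.QuantumFieldTheory.Balaban1983to89
open Literature.MathematicalPhysics.QuantumFieldTheory.Balaban1983to89.T4Continuum
open Literature.MathematicalPhysics.QuantumFieldTheory.Balaban1983to89.T4OutputRate
open Literature.MathematicalPhysics.QuantumFieldTheory.Balaban1983to89.TreeLengthTorus (TPt TDom tsys torusTreeLen torusTreeLen_nonneg)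
open Literature.MathematicalPhysics.QuantumFieldTheory.Balaban1983to89.Node00
  (Stage12Params IsDatumOfRecord₁₂C U3Objects₁₁ U3Letters₁₁ MatA ιSU prependCoupling prependCoupling_head_tail)
open Literature.MathematicalPhysics.QuantumFieldTheory.Balaban1983to89.Node00.Sect2 (domSys domCount CPair ofBackgroundC)
open Literature.MathematicalPhysics.QuantumFieldTheory.Balaban1983to89.Node00.W1
open YMDAG.UVSplit

variable {N : ℕ} [NeZero N]

/-! ## §1–§2 AT node00-def-W1 g3's READING DATA OF RECORD `ReadingData.ofRecord` (p473218): (C1)(C2) DISCHARGED; (O) and `N22At` modulo (J) + numerals + STRIP -/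

section OfRecord

variable {F : T4Family} {M : ℕ} (S : (k : ℕ) → ClusterTower (F.P k) (MatA N) M)
  (gauge : (k : ℕ) → GaugeField (F.P k) 0 (Node00.SU N) → GaugeField (F.P k) 0 (Node00.SU N) → ℝ) (hg : ∀ k U U', 0 ≤ gauge k U U')
  (transport : (k : ℕ) → GaugeField (F.P (k + 1)) 0 (Node00.SU N) → GaugeField (F.P k) 0 (Node00.SU N)) (li : LetterInputs)

omit [NeZero N] in
/-- **THE PAIRING COHERENCE (C1)(C2) HOLDS FOR THE READING DATA OF RECORD** (node00-def-W1 g3's `ReadingData.ofRecord`, whose level pairings are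
`LevelPairing.ofRecord` with `pair := pairOfRecord`): (C1) by `pairOfRecord_fst` (`rfl`), `dj_pairOfRecord`, `range_pairOfRecord = {Y | Y.1 ≠ 0}`; (C2) by `rfl` —
run A of pairing `k+1` and run B of pairing `k` are BOTH the `SU(N)` gauge fields of `F.P (k+1)` read through `ιSU N` with `𝐉 = 0`. [folklore] -/
theorem pairingCoherence_ofRecord :
    (∀ (k : ℕ) (X₁ : Node00.W1.Dom (F.P k) M), (((ReadingData.ofRecord F M N S gauge hg transport li).pairing k).pair X₁).1 = X₁.1 + 1) ∧
    (∀ (k : ℕ) (X₁ : Node00.W1.Dom (F.P k) M),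
      (domSys (F.P (k + 1)) M (((ReadingData.ofRecord F M N S gauge hg transport li).pairing k).pair X₁).1).dj
          (((ReadingData.ofRecord F M N S gauge hg transport li).pairing k).pair X₁).2 = (domSys (F.P k) M X₁.1).dj X₁.2) ∧
    (∀ (k : ℕ) (X : Node00.W1.Dom (F.P (k + 1)) M), 1 ≤ X.1 →
      ∃ X₁ : Node00.W1.Dom (F.P k) M, ((ReadingData.ofRecord F M N S gauge hg transport li).pairing k).pair X₁ = X) ∧
    (∀ (k : ℕ) (U : ((ReadingData.ofRecord F M N S gauge hg transport li).pairing (k + 1)).BgA),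
      ∃ U₁ : ((ReadingData.ofRecord F M N S gauge hg transport li).pairing k).BgB,
        ((ReadingData.ofRecord F M N S gauge hg transport li).pairing k).embB U₁ =
          ((ReadingData.ofRecord F M N S gauge hg transport li).pairing (k + 1)).embA U) := by
  refine ⟨fun k X₁ => rfl, fun k X₁ => dj_pairOfRecord F M k X₁, fun k X hX => ?_, fun k U => ⟨U, rfl⟩⟩
  have hX' : X ∈ Set.range (pairOfRecord F M k) := by
    rw [range_pairOfRecord]
    exact Nat.one_le_iff_ne_zero.mp hX
  exact hX'

omit [NeZero N] in
/-- **(O) AT THE READING DATA OF RECORD FROM NE5 BELOW, modulo the junk-freeness pin only.**  For the towers `S k` (run length `k` on `F.P k`) and the one-step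
transports `T₀`: NE5 at the pairing levels `k′ < k` in node00-def-W1's literal (`ReadingData.ne5_ofRecord_iff`: `|Re E(S k′)(X; g; (ι T₀U, 0)) − Re E(S (k′+1))(πX;
b∷g; (ιU, 0))| ≤ C₅ θ₅^{j} e^{−κ d_j(X)}`), the pin (J) «`E(S k)(X; ·; ·) = 0` for `X` of creation step `> k`», `0 ≤ C₅`, `0 ≤ θ₅ < 1` ⟹ for window histories
agreeing from `a ≤ j` on, `|Re E(S k)(X; g; (ιU, 0)) − Re E(S k)(X; g′; (ιU, 0))| ≤ (2C₅∕(1−θ₅)) θ₅^{j−a} e^{−κ d_j(X)}` (module 9 §1 with (C1)(C2) discharged). [folklore] -/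
theorem oscFading_ofRecord_of_ne5_below (k : ℕ)
    (hjunk : ∀ (k : ℕ) (X : Node00.W1.Dom (F.P k) M), k < X.1 → ∀ (g : ℕ → ℝ) (φ : CPair (F.P k) (MatA N)), functionalC (S k) g φ X = 0)
    {γ κ θ₅ C₅ : ℝ} (hC : 0 ≤ C₅) (hθ0 : 0 ≤ θ₅) (hθ1 : θ₅ < 1)
    (h5 : ∀ k' : ℕ, k' < k → ∀ b : ℝ, 0 < b → b ≤ γ → ∀ g ∈ Window γ, ∀ (U : GaugeField (F.P (k' + 1)) 0 (Node00.SU N)) (X : Node00.W1.Dom (F.P k') M),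
      |(functionalC (S k') g (ofBackgroundC (ιSU N) (transport k' U)) X).re -
          (functionalC (S (k' + 1)) (prependCoupling b g) (ofBackgroundC (ιSU N) U) (pairOfRecord F M k' X)).re| ≤
        C₅ * θ₅ ^ X.1 * Real.exp (-(κ * (domSys (F.P k') M X.1).dj X.2))) :
    ∀ g ∈ Window γ, ∀ g' ∈ Window γ, ∀ (U : GaugeField (F.P k) 0 (Node00.SU N)) (X : Node00.W1.Dom (F.P k) M) (a : ℕ), a ≤ X.1 →
      (∀ n, a ≤ n → g n = g' n) →
      |(functionalC (S k) g (ofBackgroundC (ιSU N) U) X).re - (functionalC (S k) g' (ofBackgroundC (ιSU N) U) X).re| ≤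
        2 * C₅ / (1 - θ₅) * θ₅ ^ (X.1 - a) * Real.exp (-(κ * (domSys (F.P k) M X.1).dj X.2)) := by
  -- the gauge and the letter inputs are not read: take any
  obtain ⟨hfst, hdj, hsurj, hbg⟩ :=
    pairingCoherence_ofRecord (N := N) S (fun _ _ _ => (0 : ℝ)) (fun _ _ _ => le_rfl) transport ⟨0, 0, 0, 0, 0, 0, 0, 0, 0, 0⟩
  intro g hgW g' hgW' U X a ha hag
  refine oscFading_EA_of_ne5_below
    (ReadingData.ofRecord F M N S (fun _ _ _ => (0 : ℝ)) (fun _ _ _ => le_rfl) transport ⟨0, 0, 0, 0, 0, 0, 0, 0, 0, 0⟩) γ k hfst hdj hsurj hbg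
    (fun k₁ h U₁ X₁ hk₁ => ?_) hC hθ0 hθ1 (fun k' hk' b hb0 hb h hh U₁ X₁ => h5 k' hk' b hb0 hb h hh U₁ X₁) g hgW g' hgW' U X a ha hag
  show (functionalC (S k₁) h (ofBackgroundC (ιSU N) U₁) X₁).re = 0
  rw [hjunk k₁ X₁ hk₁]
  simp

variable (θ : Stage12Params F N)

open Classical in
/-- **`N22At` AT THE LEVEL-`k` BUNDLE OF THE READING OF RECORD FROM STRIP + NODE N18 BELOW `k` — no coherence hypothesis.**  For `D := ReadingData.ofRecord F M N S
gauge hg T₀ li` at window radius `θ.γ`: a space table on the `k`-th torus with the readings `(ιU, 0)` inside + STRIP-(1.18) at every level in every coupling for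
`S k` (radius `li.r`, amplitude `li.A`, decay `li.κ`) + `∀ k′ < k, N18At (u3OfRecord₁₂ θ (D.u3Objects θ.γ) k′)` + the pin (J) + the input signs (`0 ≤ C₅`,
`2C₅∕(1−θ₅) ≤ C₀`, `0 < C₀ ≤ 2A`, `0 < θ₅ < 1`, `θ₅ ≤ μ`, `1 ≤ μ`, `0 < A`, `0 < r`, `0 < s < 1`, `0 < θ.γ`) ⟹ `N22At (u3OfRecord₁₂ θ (D.u3Objects θ.γ) k)`. [folklore] -/
theorem n22At_u3OfRecord₁₂_ofRecord_of_n18Below_stripBound (k : ℕ)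
    (sp : (j : ℕ) → (domSys (F.P k) M j).Dom → Set (CPair (F.P k) (MatA N)))
    (hsp : ∀ (j : ℕ) (U : GaugeField (F.P k) 0 (Node00.SU N)) (Y : (domSys (F.P k) M j).Dom), ofBackgroundC (ιSU N) U ∈ sp j Y)
    (hall : ∀ (j : ℕ) (g : ℕ → ℝ), g ∈ Window θ.γ → ∀ (i : ℕ) (Y : (domSys (F.P k) M j).Dom) (ψ : CPair (F.P k) (MatA N)), ψ ∈ sp j Y →
      ∃ (Ec : ℂ → ℂ) (O : Set ℂ), IsOpen O ∧ (∀ t ∈ Ioc (0 : ℝ) θ.γ, closedBall (t : ℂ) li.r ⊆ O) ∧ DifferentiableOn ℂ Ec O ∧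
        (∀ z ∈ O, ‖Ec z‖ ≤ li.A * Real.exp (-(li.κ * torusTreeLen Y.1))) ∧
        (∀ t ∈ Ioc (0 : ℝ) θ.γ, Ec t = termC (S k) j Y (Function.update g i t) ψ))
    (hjunk : ∀ (k : ℕ) (X : Node00.W1.Dom (F.P k) M), k < X.1 → ∀ (g : ℕ → ℝ) (φ : CPair (F.P k) (MatA N)), functionalC (S k) g φ X = 0)
    (h18 : ∀ k' : ℕ, k' < k → N18At (u3OfRecord₁₂ θ ((ReadingData.ofRecord F M N S gauge hg transport li).u3Objects θ.γ) k'))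
    (hC5 : 0 ≤ li.C₅) (hθ1 : li.θ₅ < 1) (hC₀' : 2 * li.C₅ / (1 - li.θ₅) ≤ li.C₀)
    (hC₀ : 0 < li.C₀) (hθ : 0 < li.θ₅) (hA : 0 < li.A) (hμ1 : 1 ≤ li.μ) (hθμ : li.θ₅ ≤ li.μ) (hCM : li.C₀ ≤ 2 * li.A)
    (hr : 0 < li.r) (hγ : 0 < θ.γ) (hs0 : 0 < li.s) (hs1 : li.s < 1) :
    N22At (u3OfRecord₁₂ θ ((ReadingData.ofRecord F M N S gauge hg transport li).u3Objects θ.γ) k) := by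
  obtain ⟨hfst, hdj, hsurj, hbg⟩ := pairingCoherence_ofRecord (N := N) S gauge hg transport li
  refine n22At_u3OfRecord₁₂_w1Reading_of_n18Below_stripBound θ (ReadingData.ofRecord F M N S gauge hg transport li) k sp hsp hall hfst hdj hsurj hbg
    (fun k₁ h U₁ X₁ hk₁ => ?_) h18 hC5 hθ1 hC₀' hC₀ hθ hA hμ1 hθμ hCM hr hγ hs0 hs1
  show (functionalC (S k₁) h (ofBackgroundC (ιSU N) U₁) X₁).re = 0
  rw [hjunk k₁ X₁ hk₁]
  simp

end OfRecord

/-! ## §3 THE EDGE N18 → N22 AT THE RATE READING OF RECORD WHOSE W1 COMPONENT IS `ReadingData.ofRecord` — modulo (J) + numerals + STRIP only -/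

section OfRecordEdge

variable (S : (F : T4Family) → (θ : Stage12Params F N) → (k : ℕ) → ClusterTower (F.P k) (MatA N) θ.τ9.M)
  (gauge : (F : T4Family) → (θ : Stage12Params F N) → (k : ℕ) → GaugeField (F.P k) 0 (Node00.SU N) → GaugeField (F.P k) 0 (Node00.SU N) → ℝ)
  (hg : ∀ (F : T4Family) (θ : Stage12Params F N) (k : ℕ) (U U' : GaugeField (F.P k) 0 (Node00.SU N)), 0 ≤ gauge F θ k U U')
  (T₀ : (F : T4Family) → (θ : Stage12Params F N) → (k : ℕ) → GaugeField (F.P (k + 1)) 0 (Node00.SU N) → GaugeField (F.P k) 0 (Node00.SU N))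
  (li : (F : T4Family) → Stage12Params F N → LetterInputs) (ℓ₃ : T4Family → Node00.NE3Letters₁₁)
  (ne2 : (F : T4Family) → Stage12Params F N → (ℕ → ℝ) → List (ULoop F) → ℕ → Node00.NE2Objects₁₁)
  (ne1 : (F : T4Family) → Stage12Params F N → (ℕ → ℝ) → List (ULoop F) → NE1pCarriers)

open Classical in
/-- **THE EDGE N18 → N22 AT THE RATE READING OF RECORD WITH W1 COMPONENT `ReadingData.ofRecord`** (dag-n22-e g2's `readingOfRecord₁₂ w1 ℓ₃ ne2 ne1` at
`w1 := fun F θ ↦ ReadingData.ofRecord F θ.τ9.M N (S F θ) (gauge F θ) (hg F θ) (T₀ F θ) (li F θ)` — node00-def-W1 g3's suggested instance): node N18's stub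
`S_N18 (RRec₁₂ 𝔯)` + per admissible Stage-12 tuple with provisos: the pin (J) for the towers `S F θ`, the letter inputs' numerals (incl. `θ₅ < 1`, `0 ≤ C₅`,
`2C₅∕(1−θ₅) ≤ C₀`, `1 ≤ μ`), and per run length `k` a space table with the readings `(ιU, 0)` inside and STRIP-(1.18) for `S F θ k` ⟹ node N22's stub `S_N22 (RRec₁₂ 𝔯)`.
The pairing coherence is DISCHARGED (§1); what remains displayed is STRIP (⇐ the level-T one-step hypothesis, modules 1∕3), (J), the numerals, and `S_N18` itself
(node N18's — a hypothesis here). [folklore] -/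
theorem s_N22_readingOfRecord₁₂_ofRecord_of_s_N18_stripBound
    (h18 : S_N18 (RRec₁₂ (readingOfRecord₁₂
      (fun F θ => ReadingData.ofRecord F θ.τ9.M N (S F θ) (gauge F θ) (hg F θ) (T₀ F θ) (li F θ)) ℓ₃ ne2 ne1)))
    (hjunk : ∀ (F : T4Family) (θ : Stage12Params F N), θ.Provisos₁₂ F N → θ.Admissible F N →
      ∀ (k : ℕ) (X : Node00.W1.Dom (F.P k) θ.τ9.M), k < X.1 → ∀ (g : ℕ → ℝ) (φ : CPair (F.P k) (MatA N)), functionalC (S F θ k) g φ X = 0)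
    (hnum : ∀ (F : T4Family) (θ : Stage12Params F N), θ.Provisos₁₂ F N → θ.Admissible F N →
      0 < (li F θ).C₀ ∧ 0 < (li F θ).θ₅ ∧ (li F θ).θ₅ < 1 ∧ 0 ≤ (li F θ).C₅ ∧ 2 * (li F θ).C₅ / (1 - (li F θ).θ₅) ≤ (li F θ).C₀ ∧ 0 < (li F θ).A ∧
        (li F θ).θ₅ ≤ (li F θ).μ ∧ (li F θ).C₀ ≤ 2 * (li F θ).A ∧ 0 < (li F θ).r ∧ 0 < (li F θ).s ∧ (li F θ).s < 1 ∧ 1 ≤ (li F θ).μ)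
    (hstrip : ∀ (F : T4Family) (θ : Stage12Params F N), θ.Provisos₁₂ F N → θ.Admissible F N → ∀ (k : ℕ),
      ∃ sp : (j : ℕ) → (domSys (F.P k) θ.τ9.M j).Dom → Set (CPair (F.P k) (MatA N)),
        (∀ (j : ℕ) (U : GaugeField (F.P k) 0 (Node00.SU N)) (Y : (domSys (F.P k) θ.τ9.M j).Dom), ofBackgroundC (ιSU N) U ∈ sp j Y) ∧
        (∀ (j : ℕ) (g : ℕ → ℝ), g ∈ Window θ.γ → ∀ (i : ℕ) (Y : (domSys (F.P k) θ.τ9.M j).Dom) (ψ : CPair (F.P k) (MatA N)), ψ ∈ sp j Y →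
          ∃ (Ec : ℂ → ℂ) (O : Set ℂ), IsOpen O ∧ (∀ t ∈ Ioc (0 : ℝ) θ.γ, closedBall (t : ℂ) (li F θ).r ⊆ O) ∧ DifferentiableOn ℂ Ec O ∧
            (∀ z ∈ O, ‖Ec z‖ ≤ (li F θ).A * Real.exp (-((li F θ).κ * torusTreeLen Y.1))) ∧
            (∀ t ∈ Ioc (0 : ℝ) θ.γ, Ec t = termC (S F θ k) j Y (Function.update g i t) ψ))) :
    S_N22 (RRec₁₂ (readingOfRecord₁₂
      (fun F θ => ReadingData.ofRecord F θ.τ9.M N (S F θ) (gauge F θ) (hg F θ) (T₀ F θ) (li F θ)) ℓ₃ ne2 ne1)) := by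
  refine s_N22_readingOfRecord₁₂_of_s_N18_stripBound _ ℓ₃ ne2 ne1 h18 (fun F θ hP hθ => ?_) hnum hstrip
  obtain ⟨hfst, hdj, hsurj, hbg⟩ := pairingCoherence_ofRecord (N := N) (S F θ) (gauge F θ) (hg F θ) (T₀ F θ) (li F θ)
  refine ⟨hfst, hdj, hsurj, hbg, fun k g U X hk => ?_⟩
  show (functionalC (S F θ k) g (ofBackgroundC (ιSU N) U) X).re = 0
  rw [hjunk F θ hP hθ k X hk]
  simp

end OfRecordEdge

end YMDAG.N22.W1

end
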